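import Mathlib.Analysis.SpecialFunctions.Pow.Real
import Mathlib.Analysis.SpecialFunctions.Trigonometric.Basic
import Summits.CriticalPhenomena.SAWScalingLimit.Theorems.SAWDefectDecoherenceTipMartingaleDefs
import HarnessLib

/-!
# Objects of the line `sector-slaving` for the crux `SAWDefectDecoherence.DefectDecoherence`
(stmt-CriticalPhenomena-8549; lead prover, crux protocol; skeleton
`Summits/CriticalPhenomena/SAWScalingLimit/Cruxes/DefectDecoherence/Lines/sector-slaving.lean`)

The crux asks for `C` and `θ > 3/4` with `‖T(Λ,a,v)‖ ≤ C R^{-θ} M(Λ,a,v)` for every simply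
connected hexagonal domain `Λ`, adjacent boundary root `a = s(u,w)` (`u ∉ Λ ∋ w`) and `R`-deep
vertex `v` (`T = defect`, `M = mass`, `Deep`, `star`, `xc` are the objects of
`SAWDefectDecoherenceTipMartingaleDefs.lean`, shared by both lines on this crux).  The line
`sector-slaving` resolves the `x_c`-weighted walks from the root by the DART through which they
arrive at a vertex and by the LIFTED arrival angle `Θ = θ_a + W`; this file only DEFINES the finite
objects its registered stubs speak about, so that the stub files under `Theorems/` and the line's
final file share one vocabulary — no statement of the line is asserted here:

* `rootAngle`, `dartUnit`, `tipPhase` — the direction `θ_a` of the root dart, the unit vector of a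
  dart, the unit-free tip phase `κ = -(ℓ/2) e^{i(5/8)θ_a}`;
* `arrivalSum Λ a θa ξ z` (`A_ξ(z)`, CLEAN twisted arrival sum) and `viaSum` (`Ā_ξ(z)`, the full
  via-dart sum, dirty walks included) — the `ξ`-characters of the lifted arrival law at `z`
  (`ξ = 0`: masses; `ξ = -3/8, 5/8, 13/8`: the sectors `U, S, D`);
* `rowD` — the right-hand side of the exact `D`-row of the nearest-neighbour sector system;
  `unstableSource`, `signalSource` (its two pure-difference sources), `cleanDefect = A_D`,
  `dressedDefect = Ā_D - A_D`; `slavingCoupling = 2 x_c sin(π/24)` (its diagonal coupling);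
* `DecayBound X C θ` — the uniform mass-relative decay predicate `‖X(Λ,a,v)‖ ≤ C R^{-θ} M(Λ,a,v)`
  over admissible configurations (the crux is definitionally `∃ C, θ > 3/4, DecayBound defect C θ`);
  `NeighbourMassBound c` — the neighbour star-mass Harnack predicate; `AprioriArrivalBound b` —
  the a-priori bound `‖A_ξ(v)‖ ≤ b·M(v)` as a predicate (it holds with `b = 1/2`).

Sources: H. Duminil-Copin, S. Smirnov, Ann. of Math. 175 (2012) (arXiv:1007.0575), Def. 1, Lemma 1
and §4; the line card `Lines/sector-slaving.md` (triage r1-1/2/3; exact rows verified by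
enumeration to `1e-13`).  Deliberately NOT here: the seven stub statements and any theorem beyond
trivial API — they live in the stub files and in the line's final file.
-/

noncomputable section

open scoped BigOperators ComplexConjugate Classical
open Literature.Probability.LatticeModels Literature.Probability.RandomPlanarGeometry.SAW
open Summit.CriticalPhenomena.SAWScalingLimit.Theorems.DefectDecoherence.TipMartingale

namespace Summit.CriticalPhenomena.SAWScalingLimit.Theorems.DefectDecoherence.SectorSlaving

/-! ### Directions -/

/-- Direction `θ_a ∈ (-π, π]` of the root dart `u → w` (the first half-step of every walk from
`a = s(u,w)` when `u ∉ Λ`), so that `e^{iθ_a} = (c_w - c_u)/‖c_w - c_u‖`. [folklore] -/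
def rootAngle (u w : HexVertex) : ℝ := Complex.arg (hexCenter w - hexCenter u)

/-- Unit vector `e(t)` of the dart `t → v`: `(c_v - c_t)/‖c_v - c_t‖` (junk `0` if `c_v = c_t`).
For `t ∼ v` the three values `e(t)` are `120°` apart. [folklore] -/
def dartUnit (v t : HexVertex) : ℂ :=
  (hexCenter v - hexCenter t) / ((‖hexCenter v - hexCenter t‖ : ℝ) : ℂ)

/-- The unit-free TIP PHASE `κ = -(ℓ/2)·e^{i(5/8)θ_a}`, `ℓ/2 = 1/(2√3) = √3/6` (half the edge length
of the embedded honeycomb lattice). [folklore] -/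
def tipPhase (u w : HexVertex) : ℂ :=
  ((-(Real.sqrt 3 / 6) : ℝ) : ℂ) * Complex.exp (((5 / 8 * rootAngle u w : ℝ) : ℂ) * Complex.I)

/-- The diagonal coupling `q = 2 x_c sin(π/24) = -2 x_c cos(13π/24) ≈ 0.1413` of the `D`-row
(the self-coupling of the defect sector). [folklore] -/
def slavingCoupling : ℝ := 2 * xc * Real.sin (Real.pi / 24)

/-! ### Twisted arrival sums -/

/-- **Clean twisted arrival sum** `A_ξ(z) = Σ_{s ∼ z} Σ_{γ : a → s(s,z), last vertex s, z ∉ γ}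
x_c^{ℓ(γ)+1} e^{-iξ(θ_a + W(γ))}`: walks arriving AT the (not yet visited) vertex `z` through one of
its darts, weighted with `z` counted, phase = character `ξ` of the LIFTED arrival direction
`Θ = θ_a + W` (a real number with `e^{iΘ}` = the unit vector of the arrival dart).  `ξ = 0`: clean
arrival mass; `ξ = -3/8, 5/8, 13/8`: the sectors `U, S, D`. [folklore] -/
def arrivalSum (Λ : Finset HexVertex) (a : Sym2 HexVertex) (θa ξ : ℝ) (z : HexVertex) : ℂ :=
  ∑ s ∈ star Λ z, ∑ γ : HexMidEdgeSAW Λ a s(s, z),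
    if γ.verts.getLast? = some s ∧ z ∉ γ.verts then
      (xc : ℂ) ^ (γ.length + 1) *
        Complex.exp (-Complex.I * (ξ : ℂ) * ((θa + γ.winding : ℝ) : ℂ))
    else 0

/-- **Full via-dart sum** `Ā_ξ(z)`: as `arrivalSum` but WITHOUT the cleanliness condition `z ∉ γ`
(walks ending on a mid-edge of `z` with last vertex a neighbour `s`, pointing into `z`; those that
visited `z` earlier are the loop-dressed = "dirty" arrivals).  `Ā_ξ - A_ξ = Dirty_ξ`. [folklore] -/
def viaSum (Λ : Finset HexVertex) (a : Sym2 HexVertex) (θa ξ : ℝ) (z : HexVertex) : ℂ :=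
  ∑ s ∈ star Λ z, ∑ γ : HexMidEdgeSAW Λ a s(s, z),
    if γ.verts.getLast? = some s then
      (xc : ℂ) ^ (γ.length + 1) *
        Complex.exp (-Complex.I * (ξ : ℂ) * ((θa + γ.winding : ℝ) : ℂ))
    else 0

/-! ### The `D`-row of the sector system and its sources -/

/-- Right-hand side of the exact `D`-row of the nearest-neighbour sector system at `v` (root dart
`u → w`): `Σ_{t ∼ v} [(1/3) ē(t)² U(t) + (2x_c cos(5π/24)/3) ē(t) S(t) + (2x_c cos(13π/24)/3) D(t)]`,
`e(t) = dartUnit v t`, `U, S, D = A_{-3/8}, A_{5/8}, A_{13/8}` at the neighbour `t`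
(one-step decomposition of the via-`t` walks at `mid{t,v}` by the dart of arrival at `t`,
character inversion over the three darts, turn `∓π/3`; `2x_c cos(π/8) = 1`). [folklore] -/
def rowD (Λ : Finset HexVertex) (u w v : HexVertex) : ℂ :=
  ∑ t ∈ star Λ v,
    ((1 / 3 : ℂ) * (starRingEnd ℂ (dartUnit v t)) ^ 2 *
          arrivalSum Λ s(u, w) (rootAngle u w) (-3 / 8) t +
        ((2 * xc * Real.cos (5 * Real.pi / 24) / 3 : ℝ) : ℂ) *
            starRingEnd ℂ (dartUnit v t) * arrivalSum Λ s(u, w) (rootAngle u w) (5 / 8) t +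
      ((2 * xc * Real.cos (13 * Real.pi / 24) / 3 : ℝ) : ℂ) *
        arrivalSum Λ s(u, w) (rootAngle u w) (13 / 8) t)

/-- The `U`-source of the `D`-row: the discrete `∂̄`-difference `Σ_{t ∼ v} ē(t)² U(t)` of the
unstable sector over the star of `v` (a pure difference: `Σ_t ē(t)² = 0`). [folklore] -/
def unstableSource (Λ : Finset HexVertex) (u w v : HexVertex) : ℂ :=
  ∑ t ∈ star Λ v, (starRingEnd ℂ (dartUnit v t)) ^ 2 * arrivalSum Λ s(u, w) (rootAngle u w) (-3 / 8) t

/-- The `S`-source of the `D`-row: the discrete `∂`-difference `Σ_{t ∼ v} ē(t) S(t)` of the signal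
sector over the star of `v` (a pure difference: `Σ_t ē(t) = 0`). [folklore] -/
def signalSource (Λ : Finset HexVertex) (u w v : HexVertex) : ℂ :=
  ∑ t ∈ star Λ v, starRingEnd ℂ (dartUnit v t) * arrivalSum Λ s(u, w) (rootAngle u w) (5 / 8) t

/-- The clean defect sector `A_D(v) = A_{13/8}(v)`. [folklore] -/
def cleanDefect (Λ : Finset HexVertex) (u w v : HexVertex) : ℂ :=
  arrivalSum Λ s(u, w) (rootAngle u w) (13 / 8) v

/-- The loop-dressed (dirty) defect `Ā_D(v) - A_D(v)`. [folklore] -/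
def dressedDefect (Λ : Finset HexVertex) (u w v : HexVertex) : ℂ :=
  viaSum Λ s(u, w) (rootAngle u w) (13 / 8) v - arrivalSum Λ s(u, w) (rootAngle u w) (13 / 8) v

/-! ### Uniform predicates over admissible configurations -/

/-- `DecayBound X C θ`: the functional `X(Λ, u, w, v)` decays against the star mass, uniformly —
`‖X‖ ≤ C R^{-θ} M(Λ,a,v)` for every simply connected `Λ`, adjacent boundary root `s(u,w)`
(`u ∉ Λ ∋ w`), `R ≥ 1` and `R`-deep `v`.  The crux `DefectDecoherence` is, definitionally,
`∃ C θ, 3/4 < θ ∧ DecayBound defect C θ`. [folklore] -/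
def DecayBound (X : Finset HexVertex → HexVertex → HexVertex → HexVertex → ℂ) (C θ : ℝ) : Prop :=
  ∀ (Λ : Finset HexVertex), hexDomainSimplyConnected Λ →
    ∀ (u w : HexVertex), hexGraph.Adj u w → u ∉ Λ → w ∈ Λ →
      ∀ (v : HexVertex) (R : ℝ), 1 ≤ R → Deep Λ v R → ‖X Λ u w v‖ ≤ C * R ^ (-θ) * mass Λ u w v

/-- `NeighbourMassBound c`: neighbour star masses are comparable, `Σ_{t ∼ v} M(t) ≤ c · M(v)`, at
every `2`-deep vertex `v` of a simply connected `Λ` with adjacent boundary root. [folklore] -/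
def NeighbourMassBound (c : ℝ) : Prop :=
  ∀ (Λ : Finset HexVertex), hexDomainSimplyConnected Λ →
    ∀ (u w : HexVertex), hexGraph.Adj u w → u ∉ Λ → w ∈ Λ →
      ∀ v : HexVertex, Deep Λ v 2 → ∑ t ∈ star Λ v, mass Λ u w t ≤ c * mass Λ u w v

/-- `AprioriArrivalBound b`: the a-priori bound `‖A_ξ(v)‖ ≤ b · M(v)` at every `1`-deep `v`
(adjacent boundary root), for every character `ξ`.  It holds with `b = 1/2`, a consequence of the
mass identity `M = x_c⁻¹ Ā_0 + 2 A_0` (the via-`v` injection); a predicate here, discharged by the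
line. [folklore] -/
def AprioriArrivalBound (b : ℝ) : Prop :=
  ∀ (Λ : Finset HexVertex) (u w : HexVertex), hexGraph.Adj u w → u ∉ Λ → w ∈ Λ →
    ∀ v : HexVertex, Deep Λ v 1 →
      ∀ ξ : ℝ, ‖arrivalSum Λ s(u, w) (rootAngle u w) ξ v‖ ≤ b * mass Λ u w v

/-! ### Trivial API -/

/-- `DecayBound` is monotone in the constant. [folklore] -/
theorem DecayBound.mono {X : Finset HexVertex → HexVertex → HexVertex → HexVertex → ℂ} {C C' θ : ℝ}
    (h : DecayBound X C θ) (hC : C ≤ C') : DecayBound X C' θ := by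
  intro Λ hΛ u w huw hu hw v R hR hdeep
  refine (h Λ hΛ u w huw hu hw v R hR hdeep).trans ?_
  have hR0 : 0 ≤ R := zero_le_one.trans hR
  exact mul_le_mul_of_nonneg_right
    (mul_le_mul_of_nonneg_right hC (Real.rpow_nonneg hR0 _)) (mass_nonneg Λ u w v)

/-- Termwise bound: each summand of a twisted arrival/via sum has norm at most the corresponding
`ξ = 0` summand, which is the nonnegative real `x_c^{ℓ+1}`. [folklore] -/
theorem norm_ite_phase_le {P : Prop} [Decidable P] (n : ℕ) (ξ θ : ℝ) :
    ‖(if P then (xc : ℂ) ^ n * Complex.exp (-Complex.I * (ξ : ℂ) * ((θ : ℝ) : ℂ)) else 0)‖ ≤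
      (if P then xc ^ n else 0 : ℝ) := by
  split_ifs
  · rw [norm_mul, norm_pow, Complex.norm_real, Real.norm_of_nonneg hexCriticalFugacity_pos_lt_one.1.le,
      Complex.norm_exp]
    have : (-Complex.I * (ξ : ℂ) * ((θ : ℝ) : ℂ)).re = 0 := by simp
    rw [this, Real.exp_zero, mul_one]
  · simp

/-- `‖A_ξ(z)‖ ≤ A_0(z)`-type bound: the norm of a clean twisted arrival sum is at most the clean
arrival MASS `Σ x_c^{ℓ+1}` (unimodular phases). [folklore] -/
theorem norm_arrivalSum_le : ∀ (Λ : Finset HexVertex) (a : Sym2 HexVertex) (θa ξ : ℝ) (z : HexVertex),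
    ‖arrivalSum Λ a θa ξ z‖ ≤ ∑ s ∈ star Λ z, ∑ γ : HexMidEdgeSAW Λ a s(s, z),
      (if γ.verts.getLast? = some s ∧ z ∉ γ.verts then xc ^ (γ.length + 1) else 0 : ℝ) := by
  intro Λ a θa ξ z
  unfold arrivalSum
  refine (norm_sum_le _ _).trans (Finset.sum_le_sum fun s _ => ?_)
  refine (norm_sum_le _ _).trans (Finset.sum_le_sum fun γ _ => ?_)
  exact norm_ite_phase_le _ _ _

end Summit.CriticalPhenomena.SAWScalingLimit.Theorems.DefectDecoherence.SectorSlaving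

end
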